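import Literature.AnabelianGeometry.AbsoluteAnabelian.MLFGaloisJannsenWingbergTwists
import HarnessLib

/-!
# `JannsenWingbergTwistsFirst` ⟹ the even-degree body of `JannsenWingbergTwists` (bookkeeping)

PROOF-ONLY companion (abc-iut cell, seat abc-iut-c312-1 gen 12, row «R14 FIRST-PLANE TWIST») of the named-fact file
`MLFGaloisJannsenWingbergTwists.lean` (v3, p500987).  One sanity lemma, no new statement (the pointwise `JWTwistPair → JWTwist` is
`Summit.ABC.IUTFork.Thm311.Real.jwTwist_of_jwTwistPair`, p501539):
* `jannsenWingbergTwists_even_of_first` — the v3 fact `JannsenWingbergTwistsFirst` (even `d`: v1's clauses + the twist on the first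
  pair) implies, at every MLF of EVEN degree `d ≥ 2` over `ℚ_p` (`p` odd), the conclusion of the v1 fact `JannsenWingbergTwists`
  verbatim (the odd-degree clause being vacuous): v3 EXTENDS v1 on even degrees, it does not compete with it.  (The two facts are
  separate existentials; at odd `d` only v1 speaks.)
A classical result about `G_k` is ASSUMED in both (Jannsen–Wingberg 1982 / NSW 7.5.14 / Hoshi–Nishio 2022 / Kondo 2025); nothing here
bears on [IUTchIII] Cor. 3.12; no side taken.  [cite: JannsenWingberg1982, Thm 2 p.75 and §5.1 p.96]
[cite: Kondo2025OuterAutMLF, §2 Thm 2.1, Lemma 2.5 and proof of Thm 2.3 p.10]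
-/

noncomputable section

namespace Literature.AnabelianGeometry.AbsoluteAnabelian

open Field ValuativeRel
open Literature.NumberTheory.GaloisRepresentations Literature.NumberTheory.GaloisRepresentations.LocalWeilDatum
open scoped ValuativeRel

/-- **v3 extends v1 on even degrees**: `JannsenWingbergTwistsFirst` gives, at every MLF `k` with odd residue characteristic `p` and
EVEN `d = [k : ℚ_p] ≥ 2`, generators and units satisfying the conclusion of `JannsenWingbergTwists` verbatim (generation, tame relation,
`[x_j] = θ(u_j)`, topological generation of the principal units, the abelianised relation, the twist pairs on Kondo's planes; the
odd-degree clause is vacuous). [cite: JannsenWingberg1982, Thm 2 p.75 and §5.1 p.96] [cite: Kondo2025OuterAutMLF, §2 Thm 2.1 and proof of Thm 2.3 p.10] -/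
theorem jannsenWingbergTwists_even_of_first (hJW : JannsenWingbergTwistsFirst)
    (k : Type) [Field k] [ValuativeRel k] [TopologicalSpace k] [IsNonarchimedeanLocalField k] [CharZero k]
    (p : ℕ) [Fact p.Prime] (hp : valuation k p < 1) (hp2 : p ≠ 2)
    (hd : letI : Algebra ℚ_[p] k := LocalField.padicAlgebra k p hp
      2 ≤ Module.finrank ℚ_[p] k)
    (hev : letI : Algebra ℚ_[p] k := LocalField.padicAlgebra k p hp
      Even (Module.finrank ℚ_[p] k)) :
    letI : Algebra ℚ_[p] k := LocalField.padicAlgebra k p hp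
    haveI : ValuativeExtension k k := ⟨fun _ _ => Iff.rfl⟩
    ∃ (σ τ : absoluteGaloisGroup k) (x : ℕ → absoluteGaloisGroup k) (u : ℕ → kˣ) (s : ℕ) (H : ℤ),
      (Subgroup.closure ({σ, τ} ∪ x '' Set.Iic (Module.finrank ℚ_[p] k))).topologicalClosure = ⊤ ∧
      σ * τ * σ⁻¹ = τ ^ Nat.card 𝓀[k] ∧
      (∀ j ≤ Module.finrank ℚ_[p] k,
        valuation k ((u j : k) - 1) < 1 ∧
        absGaloisAbProj k (x j) =
          (isReciprocitySystemE (F := k) (E := k) (isClassFieldTheory_localWeilDatum k)).theta (u j)) ∧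
      (∀ w : kˣ, valuation k ((w : k) - 1) < 1 →
        w ∈ (Subgroup.closure (u '' Set.Iic (Module.finrank ℚ_[p] k))).topologicalClosure) ∧
      0 < s ∧ H ≠ 0 ∧ IsOfFinOrder (u 0 ^ H * u 1 ^ (p ^ s)) ∧
      (Even (Module.finrank ℚ_[p] k) → ∀ i, 1 ≤ i → 2 * i + 2 ≤ Module.finrank ℚ_[p] k →
        JWTwistPair σ τ x (Module.finrank ℚ_[p] k) (2 * i + 1) (2 * i + 2)) ∧
      (Odd (Module.finrank ℚ_[p] k) → ∀ i, 1 ≤ i → 2 * i + 1 ≤ Module.finrank ℚ_[p] k →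
        JWTwistPair σ τ x (Module.finrank ℚ_[p] k) (2 * i) (2 * i + 1)) := by
  letI : Algebra ℚ_[p] k := LocalField.padicAlgebra k p hp
  haveI : ValuativeExtension k k := ⟨fun _ _ => Iff.rfl⟩
  obtain ⟨σ, τ, x, u, s, H, hgen, htame, hwild, hdense, hs, hH, htor, hplanes, -⟩ := hJW k p hp hp2 hd hev
  refine ⟨σ, τ, x, u, s, H, hgen, htame, hwild, hdense, hs, hH, htor, fun _ => hplanes, fun hodd => ?_⟩
  exact absurd hev (Nat.not_even_iff_odd.mpr hodd)

end Literature.AnabelianGeometry.AbsoluteAnabelian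

end
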